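import Literature.AlgebraicGeometry.Frobenioids.EquivalenceFrobeniusQuasiIsotropic
import Literature.AlgebraicGeometry.Frobenioids.PerfectionFunctoriality
import Literature.AlgebraicGeometry.Frobenioids.UnitTrivializationFunctoriality
import HarnessLib

/-!
# Frobenioids I, Theorem 3.4 (iii)(iv)(v): sub-DAG statements file `Thm34Sub` (S1)

Mochizuki, *The geometry of Frobenioids I: the general theory*, Kyushu J. Math. **62** (2008), kurims text
pp. 62–63 (statement of Thm. 3.4), pp. 63–69 (proof) [cite: MochizukiFrdI2008, Thm. 3.4 pp.62-63].

STATEMENTS-FIRST file of the sub-DAG `plan/L1/SUBDAG-FrdI-Thm34.md` (abc-iut-L1-lead, v1): the lemma nodes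
of [FrdI] Thm. 3.4 (iii)(iv)(v) as NAMED `Prop`s over the structure functors `F_i : C_i → F_{Φ_i}` and an
equivalence `Ψ : C₁ ≌ C₂` (the setting of abc-iut-L1-t13's discharges; operations `PreFrobenioidData.ofFunctor`,
vocabulary of abc-iut-L1-t3's `BaseCategoryTheoreticity.lean`: `PreservesMor`, `OneUniqueSquare`, `HypB`,
`PreservesDegFr`, `IsRigidFunctor`, …), plus ONE-LINE DISCHARGES where the tree already proves them.

«FSM-type» (`IsOfFSMType D_i`) is OUR repaired hypothesis replacing print's FSMFF-type where the printed
route of Thm. 3.4 (ii) is broken (PR-1; residual R2 in `plan/GAP-LEDGER.md`); every `…_FSM` statement below is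
the printed statement with that hypothesis (and `IsFrobenioid F_i`) made explicit — an OWN VARIANT in
hypotheses, never a strengthening of a printed conclusion. Typed ≠ proved: the undischarged `def`s below are
targets for the wave-4 board (`FrdI:Thm3.4(iii)/L02`, `(iii)/L01g`, `(iii)/L01p` (perfect-type uniqueness),
`(iv)/L08`, `(iv)/L09`, `(iv)/L11`, `(v)/L12a`, `(v)/L12b`, `(v)/L13`, `(v)/L14`), names frozen at filing (v2: L11
bound to the equivalence `Ψ^istr`, L01p uniqueness perfect-type conditional — abc-iut-L1-lead R71).
-/

namespace Literature.AlgebraicGeometry.Frobenioids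

namespace FrdI

namespace Thm34Sub

open CategoryTheory PreFrobenioidData

universe w v v' u u'

variable {D₁ : Type u} [Category.{v} D₁] {Φ₁ : D₁ᵒᵖ ⥤ CommMonCat.{w}} {C₁ : Type u'} [Category.{v'} C₁]
  {D₂ : Type u} [Category.{v} D₂] {Φ₂ : D₂ᵒᵖ ⥤ CommMonCat.{w}} {C₂ : Type u'} [Category.{v'} C₂]
  (F₁ : C₁ ⥤ ElemFrobenioid Φ₁) (F₂ : C₂ ⥤ ElemFrobenioid Φ₂) (Ψ : C₁ ≌ C₂)

/-! ### Hypothesis bundles -/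

/-- The hypotheses of the FSM-type variants of Thm. 3.4 (ii)/(iii) as discharged by abc-iut-L1-t13
(`FrdI.thm34iii_morphisms_of_isOfFSMType`): `C_i → F_{Φ_i}` Frobenioids of quasi-isotropic type over FSM-type
bases, `Φ_i` non-dilating, and a non-group-like object on each side (print: standard type (a) and (b), FSMFF
bases, p. 62). [cite: MochizukiFrdI2008, Thm. 3.4 (iii) p.62] -/
structure FSMHyp : Prop where
  /-- `C₁` is a Frobenioid -/
  isFrobenioid₁ : PreFrobenioid.IsFrobenioid F₁
  /-- `C₂` is a Frobenioid -/
  isFrobenioid₂ : PreFrobenioid.IsFrobenioid F₂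
  /-- `C₁` of quasi-isotropic type -/
  quasiIsotropic₁ : (ofFunctor Φ₁ F₁).IsOfQuasiIsotropicType
  /-- `C₂` of quasi-isotropic type -/
  quasiIsotropic₂ : (ofFunctor Φ₂ F₂).IsOfQuasiIsotropicType
  /-- `D₁` of FSM-type -/
  fsm₁ : IsOfFSMType D₁
  /-- `D₂` of FSM-type -/
  fsm₂ : IsOfFSMType D₂
  /-- `Φ₁` non-dilating -/
  nonDilating₁ : (ofFunctor Φ₁ F₁).IsNonDilatingOn
  /-- `Φ₂` non-dilating -/
  nonDilating₂ : (ofFunctor Φ₂ F₂).IsNonDilatingOn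
  /-- `C₁` admits a non-group-like object -/
  nonGroupLike₁ : ∃ A : C₁, ¬ (ofFunctor Φ₁ F₁).IsGroupLikeObj A
  /-- `C₂` admits a non-group-like object -/
  nonGroupLike₂ : ∃ A : C₂, ¬ (ofFunctor Φ₂ F₂).IsGroupLikeObj A

/-- The hypotheses (a) «`C₁, C₂` of standard type», (b) `HypB` of Thm. 3.4 (iii)–(v) (p. 62), over Frobenioids
with FSM-type bases (OUR repaired base hypothesis). [cite: MochizukiFrdI2008, Thm. 3.4 (iii) p.62] -/
structure StdHyp : Prop where
  /-- `C₁` is a Frobenioid -/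
  isFrobenioid₁ : PreFrobenioid.IsFrobenioid F₁
  /-- `C₂` is a Frobenioid -/
  isFrobenioid₂ : PreFrobenioid.IsFrobenioid F₂
  /-- `D₁` of FSM-type -/
  fsm₁ : IsOfFSMType D₁
  /-- `D₂` of FSM-type -/
  fsm₂ : IsOfFSMType D₂
  /-- (a) `C₁` of standard type -/
  standard₁ : (ofFunctor Φ₁ F₁).IsOfStandardType
  /-- (a) `C₂` of standard type -/
  standard₂ : (ofFunctor Φ₂ F₂).IsOfStandardType
  /-- (b) in the group-like case `Ψ` and `Ψ⁻¹` preserve base-isomorphisms -/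
  hypB : HypB (ofFunctor Φ₁ F₁) (ofFunctor Φ₂ F₂) Ψ

/-! ### Theorem 3.4 (ii), FSM-type variant (alias; DISCHARGED by abc-iut-L1-t13) -/

/-- **Thm. 3.4 (ii) over FSM-type bases**: for Frobenioids of quasi-isotropic type over FSM-type bases, `Ψ`
preserves pre-steps, co-angular pre-steps and group-like objects (hypotheses exactly those of
`FrdI.thm34ii_of_isOfFSMType`). [cite: MochizukiFrdI2008, Thm. 3.4 (ii) p.62] -/
def Thm34ii_FSM : Prop :=
  PreFrobenioid.IsFrobenioid F₁ → PreFrobenioid.IsFrobenioid F₂ →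
    (ofFunctor Φ₁ F₁).IsOfQuasiIsotropicType → (ofFunctor Φ₂ F₂).IsOfQuasiIsotropicType →
    IsOfFSMType D₁ → IsOfFSMType D₂ →
      PreservesMor Ψ.functor (ofFunctor Φ₁ F₁).IsPreStep (ofFunctor Φ₂ F₂).IsPreStep ∧
        PreservesMor Ψ.functor (ofFunctor Φ₁ F₁).IsCoAngularPreStep (ofFunctor Φ₂ F₂).IsCoAngularPreStep ∧
        PreservesObj Ψ.functor (ofFunctor Φ₁ F₁).IsGroupLikeObj (ofFunctor Φ₂ F₂).IsGroupLikeObj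

/-- `Thm34ii_FSM` holds (abc-iut-L1-t13, `FrdI.thm34ii_of_isOfFSMType`). [cite: MochizukiFrdI2008, Thm. 3.4 (ii) p.62] -/
theorem thm34ii_FSM_holds : Thm34ii_FSM F₁ F₂ Ψ :=
  fun hF₁ hF₂ hq₁ hq₂ hD₁ hD₂ => thm34ii_of_isOfFSMType hF₁ hF₂ hq₁ hq₂ hD₁ hD₂ Ψ

/-- `Thm34ii_FSM` — `_holds` alias of `thm34ii_FSM_holds` above under the fact's exact name (appended
2026-08-28, D-0026 bookkeeping: the proof term is the existing theorem of this file; no statement,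
definition or attribute is edited; no new named fact; the ledger's debt table listed the fact
unproved). [cite: MochizukiFrdI2008, Thm. 3.4 (ii) p.62] -/
theorem _root_.Literature.AlgebraicGeometry.Frobenioids.FrdI.Thm34Sub.Thm34ii_FSM_holds :
    Thm34ii_FSM F₁ F₂ Ψ :=
  _root_.Literature.AlgebraicGeometry.Frobenioids.FrdI.Thm34Sub.thm34ii_FSM_holds (F₁ := F₁) (F₂ := F₂) (Ψ := Ψ)

/-! ### Theorem 3.4 (iii) -/

/-- **(iii)/L01 `MorphismsPreserved_FSM`**: under `FSMHyp`, `Ψ` preserves morphisms of Frobenius type, linear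
morphisms, base-isomorphisms, co-angular morphisms, pull-back morphisms, isometries and LB-invertible
morphisms (p. 62 ll. 31–35). [cite: MochizukiFrdI2008, Thm. 3.4 (iii) p.62] -/
def L01_MorphismsPreserved_FSM : Prop :=
  FSMHyp F₁ F₂ →
    PreservesMor Ψ.functor (ofFunctor Φ₁ F₁).IsFrobeniusType (ofFunctor Φ₂ F₂).IsFrobeniusType ∧
      PreservesMor Ψ.functor (ofFunctor Φ₁ F₁).IsLinear (ofFunctor Φ₂ F₂).IsLinear ∧
      PreservesMor Ψ.functor (ofFunctor Φ₁ F₁).IsBaseIso (ofFunctor Φ₂ F₂).IsBaseIso ∧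
      PreservesMor Ψ.functor (ofFunctor Φ₁ F₁).IsCoAngular (ofFunctor Φ₂ F₂).IsCoAngular ∧
      PreservesMor Ψ.functor (ofFunctor Φ₁ F₁).IsPullbackMorphism (ofFunctor Φ₂ F₂).IsPullbackMorphism ∧
      PreservesMor Ψ.functor (ofFunctor Φ₁ F₁).IsIsometry (ofFunctor Φ₂ F₂).IsIsometry ∧
      PreservesMor Ψ.functor (ofFunctor Φ₁ F₁).IsLBInvertible (ofFunctor Φ₂ F₂).IsLBInvertible

/-- `L01_MorphismsPreserved_FSM` holds (abc-iut-L1-t13 p410831). [cite: MochizukiFrdI2008, Thm. 3.4 (iii) p.62] -/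
theorem l01_morphismsPreserved_FSM_holds : L01_MorphismsPreserved_FSM F₁ F₂ Ψ := fun h =>
  (thm34iii_morphisms_of_isOfFSMType h.isFrobenioid₁ h.isFrobenioid₂ h.quasiIsotropic₁ h.quasiIsotropic₂
    h.fsm₁ h.fsm₂ h.nonDilating₁ h.nonDilating₂ Ψ h.nonGroupLike₁ h.nonGroupLike₂).1

/-- **(iii)/L07 `PsiN_NonGroupLike`**: under `FSMHyp` there is an automorphism `Ψ^{ℕ_{≥1}}` of `ℕ_{≥1}` with
`deg_Fr(Ψ(φ)) = Ψ^{ℕ_{≥1}}(deg_Fr(φ))`, and it is the identity (both sides admit a non-group-like object;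
p. 62 ll. 35–41). [cite: MochizukiFrdI2008, Thm. 3.4 (iii) p.62] -/
def L07_PsiN_NonGroupLike : Prop :=
  FSMHyp F₁ F₂ →
    ∃ ΨN : ℕ+ ≃* ℕ+, (∀ ⦃A B : C₁⦄ (φ : A ⟶ B),
        (ofFunctor Φ₂ F₂).degFr (Ψ.functor.map φ) = ΨN ((ofFunctor Φ₁ F₁).degFr φ)) ∧ ΨN = MulEquiv.refl ℕ+

/-- `L07_PsiN_NonGroupLike` holds (abc-iut-L1-t13 p410831, `FrdI.degFr_map`). [cite: MochizukiFrdI2008, Thm. 3.4 (iii) p.62] -/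
theorem l07_psiN_nonGroupLike_holds : L07_PsiN_NonGroupLike F₁ F₂ Ψ := fun h =>
  (thm34iii_morphisms_of_isOfFSMType h.isFrobenioid₁ h.isFrobenioid₂ h.quasiIsotropic₁ h.quasiIsotropic₂
    h.fsm₁ h.fsm₂ h.nonDilating₁ h.nonDilating₂ Ψ h.nonGroupLike₁ h.nonGroupLike₂).2

/-- **(iii)/L01g `GroupLikeTypeCase`** (lead render; Prop. 1.14 (i): in Frobenioids of group-like type the
prime-Frobenius morphisms are the irreducible base-isomorphisms): if `C₁, C₂` are of group-like and
quasi-isotropic type over FSM-type bases and, as in hypothesis (b), `Ψ` and `Ψ⁻¹` preserve base-isomorphisms,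
then the morphism classes of (iii) are preserved and some automorphism `Ψ^{ℕ_{≥1}}` of `ℕ_{≥1}` carries
Frobenius degrees (p. 62 (b); p. 64). [cite: MochizukiFrdI2008, Thm. 3.4 (iii) p.62] -/
def L01g_GroupLikeTypeCase : Prop :=
  PreFrobenioid.IsFrobenioid F₁ → PreFrobenioid.IsFrobenioid F₂ →
    (ofFunctor Φ₁ F₁).IsOfGroupLikeType → (ofFunctor Φ₂ F₂).IsOfGroupLikeType →
    (ofFunctor Φ₁ F₁).IsOfQuasiIsotropicType → (ofFunctor Φ₂ F₂).IsOfQuasiIsotropicType →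
    IsOfFSMType D₁ → IsOfFSMType D₂ →
    PreservesMor Ψ.functor (ofFunctor Φ₁ F₁).IsBaseIso (ofFunctor Φ₂ F₂).IsBaseIso →
    PreservesMor Ψ.inverse (ofFunctor Φ₂ F₂).IsBaseIso (ofFunctor Φ₁ F₁).IsBaseIso →
      (PreservesMor Ψ.functor (ofFunctor Φ₁ F₁).IsFrobeniusType (ofFunctor Φ₂ F₂).IsFrobeniusType ∧
        PreservesMor Ψ.functor (ofFunctor Φ₁ F₁).IsLinear (ofFunctor Φ₂ F₂).IsLinear ∧
        PreservesMor Ψ.functor (ofFunctor Φ₁ F₁).IsCoAngular (ofFunctor Φ₂ F₂).IsCoAngular ∧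
        PreservesMor Ψ.functor (ofFunctor Φ₁ F₁).IsPullbackMorphism (ofFunctor Φ₂ F₂).IsPullbackMorphism ∧
        PreservesMor Ψ.functor (ofFunctor Φ₁ F₁).IsIsometry (ofFunctor Φ₂ F₂).IsIsometry ∧
        PreservesMor Ψ.functor (ofFunctor Φ₁ F₁).IsLBInvertible (ofFunctor Φ₂ F₂).IsLBInvertible) ∧
      ∃ ΨN : ℕ+ ≃* ℕ+, ∀ ⦃A B : C₁⦄ (φ : A ⟶ B),
        (ofFunctor Φ₂ F₂).degFr (Ψ.functor.map φ) = ΨN ((ofFunctor Φ₁ F₁).degFr φ)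

/-- **(iii)/L01p `PfSquare`, existence and `1`-commutativity** (in the shape consumed by abc-iut-L1-d1's
`PerfectionFunctoriality`, p411315): if `Ψ` is Frobenius-compatible (carries arrows of Frobenius type to
arrows of Frobenius type of the same degree — (iii)/L01 + L07), then `Ψ^pf : C₁^pf → C₂^pf`
(`PreFrobenioid.Perfection.map`) is an equivalence fitting into the `1`-commutative square with the natural
functors `C_i → C_i^pf` (p. 62 l. 42 – p. 63 l. 2). [cite: MochizukiFrdI2008, Thm. 3.4 (iii) p.62] -/
def L01p_PfSquareExists : Prop :=
  ∀ (hF₁ : PreFrobenioid.IsFrobenioid F₁) (hF₂ : PreFrobenioid.IsFrobenioid F₂),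
    PreFrobenioid.IsFrobeniusCompatible F₁ F₂ Ψ.functor →
      ∃ Ψpf : PreFrobenioid.Perfection hF₁ ⥤ PreFrobenioid.Perfection hF₂, Ψpf.IsEquivalence ∧
        OneCommutes Ψ.functor (PreFrobenioid.Perfection.toPf hF₂) (PreFrobenioid.Perfection.toPf hF₁) Ψpf

/-- `L01p_PfSquareExists` holds (abc-iut-L1-d1 p411315: `Perfection.map`, `map_isEquivalence`,
`toPfCompMapIso`). [cite: MochizukiFrdI2008, Thm. 3.4 (iii) p.62] -/
theorem l01p_pfSquareExists_holds : L01p_PfSquareExists F₁ F₂ Ψ := fun hF₁ hF₂ hΨ =>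
  ⟨PreFrobenioid.Perfection.map (hF₁ := hF₁) (hF₂ := hF₂) hΨ,
    PreFrobenioid.Perfection.map_isEquivalence (hF₁ := hF₁) (hF₂ := hF₂) Ψ hΨ,
    ⟨(PreFrobenioid.Perfection.toPfCompMapIso (hF₁ := hF₁) (hF₂ := hF₂) hΨ).symm⟩⟩

/-- **(iii)/L01p `PfSquare`, `1`-uniqueness — PERFECT-TYPE CONDITIONAL** (typer's call per abc-iut-L1-lead R71
and abc-iut-L1-t3's T34pf-Q1): the bare `1`-uniqueness of `Ψ^pf` among ALL functors fitting the square is what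
the typed `PreFrobenioidData.Thm34iii_pf` literally says, but the printed proof (p. 64 ll. 26–28, "immediately
from the definition of `C^pf`") only yields uniqueness among functors compatible with the Frobenioid structures;
when `C₁ → C₁^pf` is not essentially surjective the bare clause is not derivable from the square. Recorded here
in the case where it IS derivable: `C₁` of perfect type (then `C₁ → C₁^pf` is an equivalence, Prop. 3.2 (iii) /
abc-iut-L1-d1 `toPf_isEquivalence`), the square is `1`-unique (`OneUniqueSquare`). The structure-compatible
general form is a GAP-LEDGER residual, not typed here. [cite: MochizukiFrdI2008, Thm. 3.4 (iii) p.62] -/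
def L01p_PfSquareUnique_ofPerfect : Prop :=
  ∀ (hF₁ : PreFrobenioid.IsFrobenioid F₁) (hF₂ : PreFrobenioid.IsFrobenioid F₂),
    PreFrobenioid.IsFrobeniusCompatible F₁ F₂ Ψ.functor → PreFrobenioid.IsOfPerfectType F₁ →
      ∃ Ψpf : PreFrobenioid.Perfection hF₁ ⥤ PreFrobenioid.Perfection hF₂,
        OneUniqueSquare Ψ.functor (PreFrobenioid.Perfection.toPf hF₁) (PreFrobenioid.Perfection.toPf hF₂) Ψpf

/-- **(iii)/L02 `RigidityOfPfComposites`**: if moreover `D₁, D₂` are slim, each composite functor of the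
`C/C^pf` square is rigid (Prop. 1.13 (ii); p. 63 l. 2, proof p. 64 ll. 28–32).
[cite: MochizukiFrdI2008, Thm. 3.4 (iii) p.63] -/
def L02_RigidityOfPfComposites : Prop :=
  ∀ (hF₁ : PreFrobenioid.IsFrobenioid F₁) (hF₂ : PreFrobenioid.IsFrobenioid F₂), StdHyp F₁ F₂ Ψ →
    IsSlim D₁ → IsSlim D₂ →
      ∀ Ψpf : PreFrobenioid.Perfection hF₁ ⥤ PreFrobenioid.Perfection hF₂,
        OneCommutes Ψ.functor (PreFrobenioid.Perfection.toPf hF₂) (PreFrobenioid.Perfection.toPf hF₁) Ψpf →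
          IsRigidFunctor (Ψ.functor ⋙ PreFrobenioid.Perfection.toPf hF₂) ∧
            IsRigidFunctor (PreFrobenioid.Perfection.toPf hF₁ ⋙ Ψpf)

/-- **Thm. 3.4 (iii) over FSM-type bases** (the morphism/`Ψ^{ℕ_{≥1}}` part, hypotheses exactly those of
`FrdI.thm34iii_morphisms_of_isOfFSMType`): `L01 ∧ L07`. The typed `PreFrobenioidData.Thm34iii` itself (standard
type, FSMFF bases) stays open as typed (residual R2). [cite: MochizukiFrdI2008, Thm. 3.4 (iii) p.62] -/
def Thm34iii_FSM : Prop :=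
  FSMHyp F₁ F₂ →
    (PreservesMor Ψ.functor (ofFunctor Φ₁ F₁).IsFrobeniusType (ofFunctor Φ₂ F₂).IsFrobeniusType ∧
      PreservesMor Ψ.functor (ofFunctor Φ₁ F₁).IsLinear (ofFunctor Φ₂ F₂).IsLinear ∧
      PreservesMor Ψ.functor (ofFunctor Φ₁ F₁).IsBaseIso (ofFunctor Φ₂ F₂).IsBaseIso ∧
      PreservesMor Ψ.functor (ofFunctor Φ₁ F₁).IsCoAngular (ofFunctor Φ₂ F₂).IsCoAngular ∧
      PreservesMor Ψ.functor (ofFunctor Φ₁ F₁).IsPullbackMorphism (ofFunctor Φ₂ F₂).IsPullbackMorphism ∧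
      PreservesMor Ψ.functor (ofFunctor Φ₁ F₁).IsIsometry (ofFunctor Φ₂ F₂).IsIsometry ∧
      PreservesMor Ψ.functor (ofFunctor Φ₁ F₁).IsLBInvertible (ofFunctor Φ₂ F₂).IsLBInvertible) ∧
    ∃ ΨN : ℕ+ ≃* ℕ+, (∀ ⦃A B : C₁⦄ (φ : A ⟶ B),
        (ofFunctor Φ₂ F₂).degFr (Ψ.functor.map φ) = ΨN ((ofFunctor Φ₁ F₁).degFr φ)) ∧ ΨN = MulEquiv.refl ℕ+

/-- `Thm34iii_FSM` holds (abc-iut-L1-t13 p410831). [cite: MochizukiFrdI2008, Thm. 3.4 (iii) p.62] -/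
theorem thm34iii_FSM_holds : Thm34iii_FSM F₁ F₂ Ψ := fun h =>
  thm34iii_morphisms_of_isOfFSMType h.isFrobenioid₁ h.isFrobenioid₂ h.quasiIsotropic₁ h.quasiIsotropic₂
    h.fsm₁ h.fsm₂ h.nonDilating₁ h.nonDilating₂ Ψ h.nonGroupLike₁ h.nonGroupLike₂

/-- `Thm34iii_FSM` — `_holds` alias of `thm34iii_FSM_holds` above under the fact's exact name (appended
2026-08-28, D-0026 bookkeeping: the proof term is the existing theorem of this file; no statement,
definition or attribute is edited; no new named fact; the ledger's debt table listed the fact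
unproved). [cite: MochizukiFrdI2008, Thm. 3.4 (iii) p.62] -/
theorem _root_.Literature.AlgebraicGeometry.Frobenioids.FrdI.Thm34Sub.Thm34iii_FSM_holds :
    Thm34iii_FSM F₁ F₂ Ψ :=
  _root_.Literature.AlgebraicGeometry.Frobenioids.FrdI.Thm34Sub.thm34iii_FSM_holds (F₁ := F₁) (F₂ := F₂) (Ψ := Ψ)

/-! ### Theorem 3.4 (iv) -/

/-- **(iv)/L08 `UnitsDivisorsPreserved`**: under (a), (b) over FSM-type bases and (c) `D₁, D₂` Frobenius-slim,
`Ψ` preserves `O^▷(−)` and `O^×(−)` (p. 63 ll. 2–4; proof p. 66 ll. 13–30 via Prop. 3.3 (i)).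
[cite: MochizukiFrdI2008, Thm. 3.4 (iv) p.63] -/
def L08_UnitsDivisorsPreserved : Prop :=
  StdHyp F₁ F₂ Ψ → IsFrobeniusSlim D₁ → IsFrobeniusSlim D₂ →
    (∀ (A : C₁) (α : End A), α ∈ (ofFunctor Φ₁ F₁).endSubmonoid A →
        Ψ.functor.map α ∈ (ofFunctor Φ₂ F₂).endSubmonoid (Ψ.functor.obj A)) ∧
      ∀ (A : C₁) (α : Aut A), α ∈ (ofFunctor Φ₁ F₁).unitsSubgroup A →
        Ψ.functor.mapIso α ∈ (ofFunctor Φ₂ F₂).unitsSubgroup (Ψ.functor.obj A)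

/-- **(iv)/L09 `PsiN_Identity`**: under (a), (b) over FSM-type bases and (c), `Ψ^{ℕ_{≥1}}` is the identity,
i.e. `Ψ` preserves Frobenius degrees (p. 63 l. 4; proof p. 66 l. 42 – p. 67 l. 21: the non-group-like case is
L07, the group-like case uses a Frobenius-compact object of `(C^un-tr)^birat`, Prop. 1.10 (vi)).
[cite: MochizukiFrdI2008, Thm. 3.4 (iv) p.63] -/
def L09_PsiN_Identity : Prop :=
  StdHyp F₁ F₂ Ψ → IsFrobeniusSlim D₁ → IsFrobeniusSlim D₂ →
    PreservesDegFr (ofFunctor Φ₁ F₁) (ofFunctor Φ₂ F₂) Ψ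

/-- **(iv)/L09, non-group-like case** (DISCHARGED by abc-iut-L1-t13's `FrdI.degFr_map`): under `FSMHyp`, `Ψ`
preserves Frobenius degrees. [cite: MochizukiFrdI2008, Thm. 3.4 (iv) p.63] -/
theorem l09_preservesDegFr_of_FSMHyp (h : FSMHyp F₁ F₂) :
    PreservesDegFr (ofFunctor Φ₁ F₁) (ofFunctor Φ₂ F₂) Ψ := by
  intro A B φ
  obtain ⟨ΨN, hΨN, hid⟩ := l07_psiN_nonGroupLike_holds F₁ F₂ Ψ h
  rw [hΨN φ, hid]
  rfl

/-- **(iv)/L10 `UntrSquare`** (in the shape provided by abc-iut-L1-d1's `UnitTrivializationFunctoriality`,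
p411428): an equivalence `Ψ^istr : C₁^istr ≌ C₂^istr` preserving unit-equivalence in both directions induces a
`1`-unique `Ψ^un-tr : C₁^un-tr → C₂^un-tr` with the `1`-commutative square over the natural functors
`C_i^istr → C_i^un-tr` of Prop. 3.3 (iii) (p. 63 ll. 5–19; proof p. 66 ll. 31–38).
[cite: MochizukiFrdI2008, Thm. 3.4 (iv) p.63] -/
def L10_UntrSquare : Prop :=
  ∀ E : (ofFunctor Φ₁ F₁).Istr ≌ (ofFunctor Φ₂ F₂).Istr,
    PreservesUnitEquiv (ofFunctor Φ₁ F₁) (ofFunctor Φ₂ F₂) E.functor →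
      PreservesUnitEquiv (ofFunctor Φ₂ F₂) (ofFunctor Φ₁ F₁) E.inverse →
        ∃ Ψuntr : (ofFunctor Φ₁ F₁).Untr ⥤ (ofFunctor Φ₂ F₂).Untr,
          OneUniqueSquare E.functor (ofFunctor Φ₁ F₁).toUntr (ofFunctor Φ₂ F₂).toUntr Ψuntr

/-- `L10_UntrSquare` holds (abc-iut-L1-d1 p411428, `PreFrobenioidData.exists_oneUniqueSquare_untr`).
[cite: MochizukiFrdI2008, Thm. 3.4 (iv) p.63] -/
theorem l10_untrSquare_holds : L10_UntrSquare F₁ F₂ := fun _ h₁ h₂ =>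
  PreFrobenioidData.exists_oneUniqueSquare_untr h₁ h₂

/-- `L10_UntrSquare` holds for all parameters — `_holds` alias of `l10_untrSquare_holds` above
(appended 2026-08-28, D-0026 bookkeeping: the proof term is the existing theorem of this file;
no statement, definition or attribute is edited; no new named fact).
[cite: MochizukiFrdI2008, Thm. 3.4 (iv) p.63] -/
theorem L10_UntrSquare_holds : L10_UntrSquare F₁ F₂ :=
  l10_untrSquare_holds F₁ F₂

/-- **(iv)/L11 `UntrRigidity`**: if `D₁, D₂` are slim, the composite functors of the `C^istr/C^un-tr` square
are rigid, the square being taken at THE equivalence `Ψ^istr : C₁^istr ≌ C₂^istr` of Thm. 3.4 (i) (a bare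
functor would make the first conjunct false, e.g. for a constant functor; unit-trivial type, Prop. 1.13;
p. 63 ll. 20–21, proof p. 66 ll. 39–41). [cite: MochizukiFrdI2008, Thm. 3.4 (iv) p.63] -/
def L11_UntrRigidity : Prop :=
  StdHyp F₁ F₂ Ψ → IsSlim D₁ → IsSlim D₂ →
    ∀ (E : (ofFunctor Φ₁ F₁).Istr ≌ (ofFunctor Φ₂ F₂).Istr)
      (Ψuntr : (ofFunctor Φ₁ F₁).Untr ⥤ (ofFunctor Φ₂ F₂).Untr),
      OneCommutes E.functor (ofFunctor Φ₂ F₂).toUntr (ofFunctor Φ₁ F₁).toUntr Ψuntr →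
        IsRigidFunctor (E.functor ⋙ (ofFunctor Φ₂ F₂).toUntr) ∧ IsRigidFunctor ((ofFunctor Φ₁ F₁).toUntr ⋙ Ψuntr)

/-- **Thm. 3.4 (iv) over FSM-type bases**, preservation part (the conclusion of the typed
`PreFrobenioidData.Thm34iv` under (a), (b), FSM-type bases, (c) Frobenius-slim): `Ψ` preserves `O^▷(−)`,
`O^×(−)`, and `Ψ^{ℕ_{≥1}} = id`. [cite: MochizukiFrdI2008, Thm. 3.4 (iv) p.63] -/
def Thm34iv_FSM : Prop :=
  StdHyp F₁ F₂ Ψ → IsFrobeniusSlim D₁ → IsFrobeniusSlim D₂ →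
    (∀ (A : C₁) (α : End A), α ∈ (ofFunctor Φ₁ F₁).endSubmonoid A →
        Ψ.functor.map α ∈ (ofFunctor Φ₂ F₂).endSubmonoid (Ψ.functor.obj A)) ∧
      (∀ (A : C₁) (α : Aut A), α ∈ (ofFunctor Φ₁ F₁).unitsSubgroup A →
        Ψ.functor.mapIso α ∈ (ofFunctor Φ₂ F₂).unitsSubgroup (Ψ.functor.obj A)) ∧
      PreservesDegFr (ofFunctor Φ₁ F₁) (ofFunctor Φ₂ F₂) Ψ

/-- **(iv)/L00 `Assembly_iv`**: `L08 ∧ L09 → Thm34iv_FSM` (glue, PROVED). [cite: MochizukiFrdI2008, Thm. 3.4 (iv) p.63] -/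
theorem thm34iv_FSM_of (h08 : L08_UnitsDivisorsPreserved F₁ F₂ Ψ) (h09 : L09_PsiN_Identity F₁ F₂ Ψ) :
    Thm34iv_FSM F₁ F₂ Ψ := fun h hs₁ hs₂ =>
  ⟨(h08 h hs₁ hs₂).1, (h08 h hs₁ hs₂).2, h09 h hs₁ hs₂⟩

/-! ### Theorem 3.4 (v) -/

/-- **(v)/L12a `BaseIdentityEndosPreserved`**: under (a), (b) over FSM-type bases and (c) `D₁, D₂` slim, `Ψ`
preserves base-identity endomorphisms (p. 63 ll. 22–25; proof p. 67 l. 23 – p. 68, the categories `P_i`).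
[cite: MochizukiFrdI2008, Thm. 3.4 (v) p.63] -/
def L12a_BaseIdentityEndosPreserved : Prop :=
  StdHyp F₁ F₂ Ψ → IsSlim D₁ → IsSlim D₂ →
    ∀ (A : C₁) (α : A ⟶ A), (ofFunctor Φ₁ F₁).IsBaseIdentity α → (ofFunctor Φ₂ F₂).IsBaseIdentity (Ψ.functor.map α)

/-- **(v)/L12b `BaseEquivalentPairsPreserved`**: under the same hypotheses `Ψ` preserves base-equivalent pairs
of co-objective morphisms (p. 63 ll. 22–25; proof p. 67 l. 23 – p. 68). [cite: MochizukiFrdI2008, Thm. 3.4 (v) p.63] -/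
def L12b_BaseEquivalentPairsPreserved : Prop :=
  StdHyp F₁ F₂ Ψ → IsSlim D₁ → IsSlim D₂ →
    PreservesRel Ψ.functor (fun ⦃_ _⦄ φ ψ => (ofFunctor Φ₁ F₁).BaseEquivalent φ ψ)
      (fun ⦃_ _⦄ φ ψ => (ofFunctor Φ₂ F₂).BaseEquivalent φ ψ)

/-- **(v)/L13 `PsiBaseFunctor`**: under the same hypotheses, and given L12a/L12b, there is a `1`-unique
`Ψ^Base : D₁ → D₂` with the `1`-commutative projection square (`D_i` as the quotient of `C_i` by
base-equivalence, total epimorphicity; p. 63 ll. 25–36, proof p. 68 – p. 69 l. 20).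
[cite: MochizukiFrdI2008, Thm. 3.4 (v) p.63] -/
def L13_PsiBaseFunctor : Prop :=
  StdHyp F₁ F₂ Ψ → IsSlim D₁ → IsSlim D₂ →
    (∀ (A : C₁) (α : A ⟶ A), (ofFunctor Φ₁ F₁).IsBaseIdentity α → (ofFunctor Φ₂ F₂).IsBaseIdentity (Ψ.functor.map α)) →
    PreservesRel Ψ.functor (fun ⦃_ _⦄ φ ψ => (ofFunctor Φ₁ F₁).BaseEquivalent φ ψ)
      (fun ⦃_ _⦄ φ ψ => (ofFunctor Φ₂ F₂).BaseEquivalent φ ψ) →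
      ∃ ΨBase : D₁ ⥤ D₂, OneUniqueSquare Ψ.functor (ofFunctor Φ₁ F₁).base (ofFunctor Φ₂ F₂).base ΨBase

/-- **(v)/L14 `BaseRigidity`**: under the same hypotheses each composite functor of the `C/D` square is rigid
(Prop. 1.13 (i); p. 63 ll. 36–37, proof p. 69 ll. 20–26). [cite: MochizukiFrdI2008, Thm. 3.4 (v) p.63] -/
def L14_BaseRigidity : Prop :=
  StdHyp F₁ F₂ Ψ → IsSlim D₁ → IsSlim D₂ →
    ∀ ΨBase : D₁ ⥤ D₂, OneCommutes Ψ.functor (ofFunctor Φ₂ F₂).base (ofFunctor Φ₁ F₁).base ΨBase →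
      IsRigidFunctor (Ψ.functor ⋙ (ofFunctor Φ₂ F₂).base) ∧ IsRigidFunctor ((ofFunctor Φ₁ F₁).base ⋙ ΨBase)

/-- **Thm. 3.4 (v) over FSM-type bases** (the conclusion of the typed `PreFrobenioidData.Thm34v` under (a),
(b), FSM-type bases, (c) slim). [cite: MochizukiFrdI2008, Thm. 3.4 (v) p.63] -/
def Thm34v_FSM : Prop :=
  StdHyp F₁ F₂ Ψ → IsSlim D₁ → IsSlim D₂ →
    (∀ (A : C₁) (α : A ⟶ A), (ofFunctor Φ₁ F₁).IsBaseIdentity α → (ofFunctor Φ₂ F₂).IsBaseIdentity (Ψ.functor.map α)) ∧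
      PreservesRel Ψ.functor (fun ⦃_ _⦄ φ ψ => (ofFunctor Φ₁ F₁).BaseEquivalent φ ψ)
        (fun ⦃_ _⦄ φ ψ => (ofFunctor Φ₂ F₂).BaseEquivalent φ ψ) ∧
      ∃ ΨBase : D₁ ⥤ D₂, OneUniqueSquare Ψ.functor (ofFunctor Φ₁ F₁).base (ofFunctor Φ₂ F₂).base ΨBase ∧
        IsRigidFunctor (Ψ.functor ⋙ (ofFunctor Φ₂ F₂).base) ∧ IsRigidFunctor ((ofFunctor Φ₁ F₁).base ⋙ ΨBase)

/-- **(v)/L00 `Assembly_v`**: `L12a ∧ L12b ∧ L13 ∧ L14 → Thm34v_FSM` (glue, PROVED).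
[cite: MochizukiFrdI2008, Thm. 3.4 (v) p.63] -/
theorem thm34v_FSM_of (h12a : L12a_BaseIdentityEndosPreserved F₁ F₂ Ψ)
    (h12b : L12b_BaseEquivalentPairsPreserved F₁ F₂ Ψ) (h13 : L13_PsiBaseFunctor F₁ F₂ Ψ)
    (h14 : L14_BaseRigidity F₁ F₂ Ψ) : Thm34v_FSM F₁ F₂ Ψ := fun h hs₁ hs₂ => by
  obtain ⟨ΨBase, hsq⟩ := h13 h hs₁ hs₂ (h12a h hs₁ hs₂) (h12b h hs₁ hs₂)
  exact ⟨h12a h hs₁ hs₂, h12b h hs₁ hs₂, ΨBase, hsq, h14 h hs₁ hs₂ ΨBase hsq.2.1⟩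

end Thm34Sub

end FrdI

end Literature.AlgebraicGeometry.Frobenioids
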